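import Summits.AtomisticToContinuum.HydrodynamicLimit.Theorems.AntiMazurCoboundariesKineticWindowGronwallFamilyGluePrelim
import HarnessLib

/-!
# Family glue, file 3 of 3: thresholds pointwise in the local Gibbs profile upgrade to thresholds uniform along
# jointly continuous families (stub `stub_familyGlue`, line `rare-band-ladder-dock` v7, crux `KineticWindowGronwall`)

Crux `Summit.AtomisticToContinuum.HydrodynamicLimit.Theses.AntiMazurCoboundaries.KineticWindowGronwall`
(stmt-AtomisticToContinuum-9282). `FamilyGlue := LocalQuadraticWindowLDBounds → LocalQuadraticWindowLDFamily`: if the local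
quadratic-class window LD in product form holds PROFILE BY PROFILE with an amplitude depending on the profile only through
`(θ-range, drift bound, σ)` (thresholds pointwise, all windows), then it holds UNIFORMLY along every jointly continuous
family `s ↦ (a_s, θ_s, u_s)`, `s ∈ [0,t₁]`. Proof (`familyGlue_of`, given the three helper statements of file 2): bounds
of the family on the compact slab; `c⋆ := c⋆_B/(24 C₂ C₃)`; given `(φ, g, ε)`: tail cut-off `t = t₀ + α + γ‖·‖²`
(`TailReorth`), bulk modulus of `g`, Rényi tolerance `ρ(ε/4)` (`TwoProfileTransfer`), slab modulus `δs` of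
`log a, θ, u, (√θ)⁻¹, φ`, finite net `s'_k = kδs`, the hypothesis at each net point on `(φ(s'_k,·), 6g)` and `(1, 12c⋆C₂C₃t₀)`
at `ε/2`, `τ₀ := max`, `N₀ := max`; for `s` and its net point `s'`: change of measure `λ_s → λ_{s'}`
(`∫e^S dλ_s ≤ e^{ε(N+1)/4}(∫e^{2S}dλ_{s'})^{1/2}`), pointwise three-piece comparison (file 1), inequality rank split with
the three bounds (node; `WindowEnergyMoment`; node on the tail), total `≤ e^{ε(N+1)}`.

References: OllaVaradhanYau1993 §3; KipnisLandim1999 Ch. 6.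
-/


noncomputable section

namespace Summit.AtomisticToContinuum.HydrodynamicLimit.Theorems.KineticWindowGronwallFamilyGlue

open MeasureTheory Set Filter Metric
open scoped ENNReal BigOperators
open Literature.Analysis.FluidPDE Literature.MathematicalPhysics.KineticTheory

/-! ## §3 The glue -/

/-- **THE FAMILY GLUE from the three helper statements**: `TwoProfileTransfer → WindowEnergyMoment → TailReorth →
(LocalQuadraticWindowLDBounds → LocalQuadraticWindowLDFamily)`. See the module docstring for the proof.
[cite: OllaVaradhanYau1993, §3] -/
theorem familyGlue_of (hT : TwoProfileTransfer) (hE : WindowEnergyMoment) (hR : TailReorth) : FamilyGlue := by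
  intro hB
  obtain ⟨η₀, hη₀, HB⟩ := hB
  refine ⟨min η₀ (1 / 16), lt_min hη₀ (by norm_num), ?_⟩
  intro t₁ a θ₀ u₀ hac hθc huc ha0 hθ0 σ hσ hguard
  rcases lt_or_ge t₁ 0 with ht₁ | ht₁
  · -- empty time interval: the conclusion is vacuous
    refine ⟨1, one_pos, fun Φ φ g _ _ _ _ _ ε _ => ⟨1, one_pos, fun τ _ => ⟨0, fun N _ s hs => ?_⟩⟩⟩
    exact absurd (hs.1.trans hs.2) (not_le.2 ht₁)
  -- slices of the family are continuous
  have hac_s : ∀ s, Continuous (a s) := fun s => hac.uncurry_left s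
  have hθc_s : ∀ s, Continuous (θ₀ s) := fun s => hθc.uncurry_left s
  have huc_s : ∀ s, Continuous (u₀ s) := fun s => huc.uncurry_left s
  -- bounds of the family on the slab
  obtain ⟨θm, θM, ⟨sₘ, hsₘ, xₘ, hθmeq⟩, hθm_le, hθM_ge⟩ := exists_slab_bounds hθc ht₁
  have hθm : 0 < θm := by rw [← hθmeq]; exact hθ0 sₘ xₘ
  have hθmM : θm ≤ θM := (hθm_le sₘ hsₘ xₘ).trans (hθM_ge sₘ hsₘ xₘ)
  have hθM : 0 < θM := hθm.trans_le hθmM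
  have hun : Continuous (Function.uncurry fun s x => ‖u₀ s x‖) := huc.norm
  obtain ⟨-, U, -, -, hU_ge⟩ := exists_slab_bounds hun ht₁
  have h0mem : (0 : ℝ) ∈ Icc (0 : ℝ) t₁ := ⟨le_rfl, ht₁⟩
  have hU : 0 ≤ U := (norm_nonneg _).trans (hU_ge 0 h0mem 0)
  -- `σ ≤ 1/2` from the guard at `s = 0`
  have hσ2 : σ ≤ 1 / 2 := sigma_le_half_of_guard (hac_s 0) (ha0 0) (min_le_right _ _) (hguard 0 h0mem)
  -- the hypothesis at the bounds of the family, the energy constants, the amplitude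
  obtain ⟨cB, hcB, HcB⟩ := HB θm θM U hθm hθmM hU σ hσ
  obtain ⟨lam₀, hlam₀, CE, hCE, HE⟩ := hE θM U hθM hU
  have hK₂ : 1 ≤ C₂ θm U := one_le_C₂ (U := U) hθm
  have hK₃ : 1 ≤ C₃ θM U := one_le_C₃ (U := U) hθM
  have hK₂0 : 0 < C₂ θm U := by linarith
  have hK₃0 : 0 < C₃ θM U := by linarith
  obtain ⟨c, hcdef⟩ : ∃ c : ℝ, c = cB / (24 * C₂ θm U * C₃ θM U) := ⟨_, rfl⟩
  have hc : 0 < c := by rw [hcdef]; positivity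
  have h24c : 24 * c * C₂ θm U * C₃ θM U = cB := by rw [hcdef]; field_simp
  have h6c : 6 * c ≤ cB := by
    have h1 : 1 ≤ C₂ θm U * C₃ θM U := by nlinarith
    have : 6 * c * 1 ≤ 6 * c * (C₂ θm U * C₃ θM U) := mul_le_mul_of_nonneg_left h1 (by positivity)
    nlinarith
  refine ⟨c, hc, ?_⟩
  intro Φ φ g hφc hgc hφ1 hgb horth ε hε
  have hφc_s : ∀ s, Continuous (φ s) := fun s => hφc.uncurry_left s
  -- the effective accuracy `ε' ≤ ε`, small enough for the energy amplitude
  obtain ⟨ε', hε'def⟩ : ∃ ε' : ℝ, ε' = min ε (CE * lam₀) := ⟨_, rfl⟩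
  have hε' : 0 < ε' := by rw [hε'def]; exact lt_min hε (mul_pos hCE hlam₀)
  have hε'ε : ε' ≤ ε := by rw [hε'def]; exact min_le_left _ _
  have hε'C : ε' ≤ CE * lam₀ := by rw [hε'def]; exact min_le_right _ _
  have hε'2 : 0 < ε' / 2 := by positivity
  -- the three budgets of the quadratic remainder: `Λ = ω c C₂ + η + 2 c C₂ C₃ ηt (1 + C₂) ≤ 3 B₀`, `6 CE Λ ≤ ε'/2`
  obtain ⟨B₀, hB₀def⟩ : ∃ B₀ : ℝ, B₀ = ε' / (36 * CE) := ⟨_, rfl⟩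
  have hB₀ : 0 < B₀ := by rw [hB₀def]; positivity
  obtain ⟨ω, hωdef⟩ : ∃ ω : ℝ, ω = B₀ / (c * C₂ θm U + 1) := ⟨_, rfl⟩
  have hω : 0 < ω := by rw [hωdef]; positivity
  obtain ⟨ηt, hηtdef⟩ : ∃ ηt : ℝ, ηt = min 1 (B₀ / (2 * c * C₂ θm U * C₃ θM U * (1 + C₂ θm U) + 1)) := ⟨_, rfl⟩
  have hηt : 0 < ηt := by rw [hηtdef]; exact lt_min one_pos (by positivity)
  have hηt1 : ηt ≤ 1 := by rw [hηtdef]; exact min_le_left _ _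
  obtain ⟨Λ, hΛdef⟩ : ∃ Λ : ℝ, Λ = ω * c * C₂ θm U + B₀ + 2 * c * C₂ θm U * C₃ θM U * ηt * (1 + C₂ θm U) :=
    ⟨_, rfl⟩
  have hΛ0 : 0 ≤ Λ := by rw [hΛdef]; positivity
  have hΛ : Λ ≤ 3 * B₀ := by
    have h1 : ω * c * C₂ θm U ≤ B₀ := by
      have hpos : 0 < c * C₂ θm U + 1 := by positivity
      have e : ω * (c * C₂ θm U + 1) = B₀ := by rw [hωdef]; field_simp
      have h : ω * (c * C₂ θm U) ≤ ω * (c * C₂ θm U + 1) :=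
        mul_le_mul_of_nonneg_left (le_add_of_nonneg_right zero_le_one) hω.le
      calc ω * c * C₂ θm U = ω * (c * C₂ θm U) := by ring
        _ ≤ ω * (c * C₂ θm U + 1) := h
        _ = B₀ := e
    have h3 : 2 * c * C₂ θm U * C₃ θM U * ηt * (1 + C₂ θm U) ≤ B₀ := by
      have hnn : 0 ≤ 2 * c * C₂ θm U * C₃ θM U * (1 + C₂ θm U) := by positivity
      have hpos : 0 < 2 * c * C₂ θm U * C₃ θM U * (1 + C₂ θm U) + 1 := by positivity
      have hle : ηt ≤ B₀ / (2 * c * C₂ θm U * C₃ θM U * (1 + C₂ θm U) + 1) := by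
        rw [hηtdef]; exact min_le_right _ _
      have h := (le_div_iff₀ hpos).1 hle
      have h' : ηt * (2 * c * C₂ θm U * C₃ θM U * (1 + C₂ θm U)) ≤
          ηt * (2 * c * C₂ θm U * C₃ θM U * (1 + C₂ θm U) + 1) :=
        mul_le_mul_of_nonneg_left (le_add_of_nonneg_right zero_le_one) hηt.le
      calc 2 * c * C₂ θm U * C₃ θM U * ηt * (1 + C₂ θm U)
          = ηt * (2 * c * C₂ θm U * C₃ θM U * (1 + C₂ θm U)) := by ring
        _ ≤ _ := h'
        _ ≤ B₀ := h
    rw [hΛdef]; linarith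
  have hCElam : CE * (6 * Λ) ≤ ε' / 2 := by
    have : CE * (6 * Λ) ≤ CE * (18 * B₀) := mul_le_mul_of_nonneg_left (by linarith) hCE.le
    have h18 : CE * (18 * B₀) = ε' / 2 := by rw [hB₀def]; field_simp; ring
    linarith
  have hlam0 : 0 ≤ 6 * Λ := by positivity
  have hlamle : 6 * Λ ≤ lam₀ := by
    have h1 : CE * (6 * Λ) ≤ CE * lam₀ := by linarith
    exact le_of_mul_le_mul_left h1 hCE
  -- the tail cut-off and its re-orthogonalised core `t₀`
  obtain ⟨R, -, hR1, t, α, γ, htc, hα, hγ, ht0, ht1, htR, -, htorth⟩ := hR ηt hηt 0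
  have hR0 : 0 ≤ R := zero_le_one.trans hR1
  let t₀ : V3 → ℝ := fun w => t w - (α + γ * ‖w‖ ^ 2)
  have ht₀c : Continuous t₀ := htc.sub (continuous_const.add (continuous_const.mul (continuous_norm.pow 2)))
  have hsplit : ∀ w, t w = t₀ w + (α + γ * ‖w‖ ^ 2) := fun w => by simp only [t₀]; ring
  have ht₀b : ∀ w, |t₀ w| ≤ 2 * (1 + ‖w‖ ^ 2) := by
    intro w
    have h1 : |t w| ≤ 1 + ‖w‖ ^ 2 := by rw [abs_of_nonneg (ht0 w)]; exact ht1 w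
    have h2 : |α| ≤ 1 := hα.trans hηt1
    have h3 : |γ * ‖w‖ ^ 2| ≤ ‖w‖ ^ 2 := by
      rw [abs_mul, abs_of_nonneg (sq_nonneg ‖w‖)]
      exact (mul_le_mul_of_nonneg_right (hγ.trans hηt1) (sq_nonneg _)).trans (one_mul _).le
    have h4 : |t₀ w| ≤ |t w| + (|α| + |γ * ‖w‖ ^ 2|) :=
      (abs_sub _ _).trans (by gcongr; exact abs_add_le _ _)
    linarith
  -- the two observables fed to the node at the net points
  let g₆ : V3 → ℝ := fun w => 6 * g w
  let gt : V3 → ℝ := fun w => 12 * c * C₂ θm U * C₃ θM U * t₀ w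
  have hg₆c : Continuous g₆ := continuous_const.mul hgc
  have hgtc : Continuous gt := continuous_const.mul ht₀c
  have hg₆o : Orth g₆ := KineticWindowGronwallLadder.orth_const_mul 6 horth
  have hgto : Orth gt := KineticWindowGronwallLadder.orth_const_mul _ htorth
  have hg₆b : ∀ w, |g₆ w| ≤ cB * (1 + ‖w‖ ^ 2) := fun w => by
    show |6 * g w| ≤ cB * (1 + ‖w‖ ^ 2)
    rw [abs_mul, Nat.abs_ofNat]
    calc 6 * |g w| ≤ 6 * (c * (1 + ‖w‖ ^ 2)) := by gcongr; exact hgb w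
      _ = (6 * c) * (1 + ‖w‖ ^ 2) := by ring
      _ ≤ cB * (1 + ‖w‖ ^ 2) := mul_le_mul_of_nonneg_right h6c (by positivity)
  have hgtb : ∀ w, |gt w| ≤ cB * (1 + ‖w‖ ^ 2) := fun w => by
    have hk : 0 ≤ 12 * c * C₂ θm U * C₃ θM U := by positivity
    show |12 * c * C₂ θm U * C₃ θM U * t₀ w| ≤ cB * (1 + ‖w‖ ^ 2)
    rw [abs_mul, abs_of_nonneg hk]
    calc 12 * c * C₂ θm U * C₃ θM U * |t₀ w| ≤ 12 * c * C₂ θm U * C₃ θM U * (2 * (1 + ‖w‖ ^ 2)) :=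
          mul_le_mul_of_nonneg_left (ht₀b w) hk
      _ = (24 * c * C₂ θm U * C₃ θM U) * (1 + ‖w‖ ^ 2) := by ring
      _ = cB * (1 + ‖w‖ ^ 2) := by rw [h24c]
  -- the bulk modulus of `g`
  have hsqm : 0 < Real.sqrt θm := Real.sqrt_pos.2 hθm
  obtain ⟨Rb, hRbdef⟩ : ∃ Rb : ℝ, Rb = (U + Real.sqrt θM * R + U) / Real.sqrt θm := ⟨_, rfl⟩
  have hRb : 0 ≤ Rb := by rw [hRbdef]; positivity
  obtain ⟨κg, hκg, Hκg⟩ : ∃ κg : ℝ, 0 < κg ∧ ∀ w ∈ closedBall (0 : V3) (Rb + 1),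
      ∀ w' ∈ closedBall (0 : V3) (Rb + 1), dist w w' < κg → dist (g w) (g w') < B₀ := by
    have hK : IsCompact (closedBall (0 : V3) (Rb + 1)) := isCompact_closedBall _ _
    have hUg := hK.uniformContinuousOn_of_continuous hgc.continuousOn
    rw [Metric.uniformContinuousOn_iff] at hUg
    exact hUg B₀ hB₀
  obtain ⟨κ', hκ'def⟩ : ∃ κ' : ℝ, κ' = min (κg / 2) 1 := ⟨_, rfl⟩
  have hκ' : 0 < κ' := by rw [hκ'def]; exact lt_min (by positivity) one_pos
  have hκ'1 : κ' ≤ 1 := by rw [hκ'def]; exact min_le_right _ _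
  have hκ'g : κ' ≤ κg / 2 := by rw [hκ'def]; exact min_le_left _ _
  have hmod : ∀ w w', ‖w‖ ≤ (U + Real.sqrt θM * R + U) / Real.sqrt θm → ‖w - w'‖ ≤ κ' →
      |g w - g w'| ≤ B₀ := by
    intro w w' hw hww'
    rw [← hRbdef] at hw
    have h1 : w ∈ closedBall (0 : V3) (Rb + 1) := by
      rw [mem_closedBall, dist_zero_right]; linarith
    have h2 : w' ∈ closedBall (0 : V3) (Rb + 1) := by
      rw [mem_closedBall, dist_zero_right]
      have : ‖w'‖ ≤ ‖w‖ + ‖w - w'‖ := by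
        calc ‖w'‖ = ‖w - (w - w')‖ := by rw [sub_sub_cancel]
          _ ≤ ‖w‖ + ‖w - w'‖ := norm_sub_le _ _
      linarith
    have h3 : dist w w' < κg := by rw [dist_eq_norm]; linarith
    have := Hκg w h1 w' h2 h3
    rw [Real.dist_eq] at this
    exact this.le
  -- frame tolerances
  obtain ⟨κ₁, hκ₁def⟩ : ∃ κ₁ : ℝ, κ₁ = κ' / (2 * (U + Real.sqrt θM * R + U + 1)) := ⟨_, rfl⟩
  have hκ₁ : 0 < κ₁ := by rw [hκ₁def]; positivity
  obtain ⟨κu, hκudef⟩ : ∃ κu : ℝ, κu = κ' * Real.sqrt θm / 2 := ⟨_, rfl⟩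
  have hκu : 0 < κu := by rw [hκudef]; positivity
  have hκsum : κ₁ * (U + Real.sqrt θM * R + U) + κu / Real.sqrt θm ≤ κ' := by
    have hpos : 0 < U + Real.sqrt θM * R + U + 1 := by positivity
    have h1 : κ₁ * (U + Real.sqrt θM * R + U) ≤ κ₁ * (U + Real.sqrt θM * R + U + 1) :=
      mul_le_mul_of_nonneg_left (le_add_of_nonneg_right zero_le_one) hκ₁.le
    have h1' : κ₁ * (U + Real.sqrt θM * R + U + 1) = κ' / 2 := by
      rw [hκ₁def]; field_simp
    have h2 : κu / Real.sqrt θm = κ' / 2 := by rw [hκudef]; field_simp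
    rw [h2]; linarith
  -- the Rényi tolerance at budget `ε'/4`
  obtain ⟨ρ, hρ, HT⟩ := hT θm θM hθm hθmM (ε' / 4) (by positivity)
  -- slab moduli of `log a`, `θ₀`, `u₀`, `(√θ₀)⁻¹`, `φ`
  have hlogc : Continuous (Function.uncurry fun s x => Real.log (a s x)) :=
    hac.log fun p => (ha0 p.1 p.2).ne'
  have hisqc : Continuous (Function.uncurry fun s x => (Real.sqrt (θ₀ s x))⁻¹) :=
    (Real.continuous_sqrt.comp hθc).inv₀ fun p => (Real.sqrt_pos.2 (hθ0 p.1 p.2)).ne'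
  obtain ⟨δ₁, hδ₁, Hδ₁⟩ := exists_slab_modulus hlogc t₁ hρ
  obtain ⟨δ₂, hδ₂, Hδ₂⟩ := exists_slab_modulus hθc t₁ hρ
  obtain ⟨δ₃, hδ₃, Hδ₃⟩ := exists_slab_modulus huc t₁ (lt_min hρ hκu)
  obtain ⟨δ₄, hδ₄, Hδ₄⟩ := exists_slab_modulus hisqc t₁ hκ₁
  obtain ⟨δ₅, hδ₅, Hδ₅⟩ := exists_slab_modulus hφc t₁ hω
  obtain ⟨δs, hδsdef⟩ : ∃ δs : ℝ, δs = min (min (min δ₁ δ₂) (min δ₃ δ₄)) δ₅ := ⟨_, rfl⟩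
  have hδs : 0 < δs := by rw [hδsdef]; exact lt_min (lt_min (lt_min hδ₁ hδ₂) (lt_min hδ₃ hδ₄)) hδ₅
  have hδs1 : δs ≤ δ₁ := by rw [hδsdef]; exact (min_le_left _ _).trans ((min_le_left _ _).trans (min_le_left _ _))
  have hδs2 : δs ≤ δ₂ := by rw [hδsdef]; exact (min_le_left _ _).trans ((min_le_left _ _).trans (min_le_right _ _))
  have hδs3 : δs ≤ δ₃ := by rw [hδsdef]; exact (min_le_left _ _).trans ((min_le_right _ _).trans (min_le_left _ _))
  have hδs4 : δs ≤ δ₄ := by rw [hδsdef]; exact (min_le_left _ _).trans ((min_le_right _ _).trans (min_le_right _ _))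
  have hδs5 : δs ≤ δ₅ := by rw [hδsdef]; exact min_le_right _ _
  -- the net `s'_k = k δs`, `k ≤ Kmax`
  obtain ⟨Kmax, hKmaxdef⟩ : ∃ K : ℕ, K = ⌊t₁ / δs⌋₊ := ⟨_, rfl⟩
  let sk : Fin (Kmax + 1) → ℝ := fun k => (k : ℝ) * δs
  have hsk_mem : ∀ k, sk k ∈ Icc (0 : ℝ) t₁ := by
    intro k
    refine ⟨by positivity, ?_⟩
    have hk : ((k : ℕ) : ℝ) ≤ (Kmax : ℝ) := by exact_mod_cast Nat.lt_succ_iff.1 k.2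
    calc ((k : ℕ) : ℝ) * δs ≤ (Kmax : ℝ) * δs := mul_le_mul_of_nonneg_right hk hδs.le
      _ ≤ t₁ / δs * δs := by
          rw [hKmaxdef]; exact mul_le_mul_of_nonneg_right (Nat.floor_le (div_nonneg ht₁ hδs.le)) hδs.le
      _ = t₁ := div_mul_cancel₀ t₁ hδs.ne'
  have hguardk : ∀ k, σ ^ 3 * (⨆ x, a (sk k) x) ≤ η₀ * ∫ x, a (sk k) x := by
    intro k
    refine (hguard (sk k) (hsk_mem k)).trans ?_
    exact mul_le_mul_of_nonneg_right (min_le_left _ _) (integral_nonneg fun x => (ha0 _ x).le)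
  -- the node at the net points, on `(φ(s'_k, ·), 6g)` and on `(1, gt)`
  have H1 := fun k : Fin (Kmax + 1) =>
    HcB (a (sk k)) (θ₀ (sk k)) (u₀ (sk k)) (hac_s _) (hθc_s _) (huc_s _) (ha0 _)
      (hθm_le _ (hsk_mem k)) (hθM_ge _ (hsk_mem k)) (hU_ge _ (hsk_mem k)) (hguardk k) Φ
      (φ (sk k)) g₆ (hφc_s _) hg₆c (hφ1 _) hg₆b hg₆o (ε' / 2) hε'2
  have H2 := fun k : Fin (Kmax + 1) =>
    HcB (a (sk k)) (θ₀ (sk k)) (u₀ (sk k)) (hac_s _) (hθc_s _) (huc_s _) (ha0 _)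
      (hθm_le _ (hsk_mem k)) (hθM_ge _ (hsk_mem k)) (hU_ge _ (hsk_mem k)) (hguardk k) Φ
      (fun _ => (1 : ℝ)) gt continuous_const hgtc (fun _ => by norm_num) hgtb hgto (ε' / 2) hε'2
  choose τ1 hτ1 Hτ1 using H1
  choose τ2 hτ2 Hτ2 using H2
  obtain ⟨τ₀, hτ₀def⟩ : ∃ τ₀ : ℝ,
      τ₀ = max (Finset.univ.sup' Finset.univ_nonempty τ1) (Finset.univ.sup' Finset.univ_nonempty τ2) := ⟨_, rfl⟩
  have hτ₀1 : ∀ k, τ1 k ≤ τ₀ := fun k => hτ₀def ▸ (Finset.le_sup' τ1 (Finset.mem_univ k)).trans (le_max_left _ _)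
  have hτ₀2 : ∀ k, τ2 k ≤ τ₀ := fun k => hτ₀def ▸ (Finset.le_sup' τ2 (Finset.mem_univ k)).trans (le_max_right _ _)
  have hτ₀ : 0 < τ₀ := (hτ1 0).trans_le (hτ₀1 0)
  refine ⟨τ₀, hτ₀, fun τ hτ => ?_⟩
  have hτpos : 0 < τ := hτ₀.trans_le hτ
  have H1' := fun k : Fin (Kmax + 1) => Hτ1 k τ ((hτ₀1 k).trans hτ)
  have H2' := fun k : Fin (Kmax + 1) => Hτ2 k τ ((hτ₀2 k).trans hτ)
  choose N1 HN1 using H1'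
  choose N2 HN2 using H2'
  obtain ⟨N₀, hN₀def⟩ : ∃ N₀ : ℕ,
      N₀ = max (Finset.univ.sup' Finset.univ_nonempty N1) (Finset.univ.sup' Finset.univ_nonempty N2) := ⟨_, rfl⟩
  have hN₀1 : ∀ k, N1 k ≤ N₀ := fun k => hN₀def ▸ (Finset.le_sup' N1 (Finset.mem_univ k)).trans (le_max_left _ _)
  have hN₀2 : ∀ k, N2 k ≤ N₀ := fun k => hN₀def ▸ (Finset.le_sup' N2 (Finset.mem_univ k)).trans (le_max_right _ _)
  refine ⟨N₀, fun N hN s hs => ?_⟩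
  -- ### the chain for `(N, s)`: net point, change of measure, comparison, rank split
  have hN1pos : (0 : ℝ) < (N : ℝ) + 1 := by positivity
  have hℓ : (0 : ℝ) < ((N : ℝ) + 1) ^ (-(1 / 3 : ℝ)) := Real.rpow_pos_of_pos hN1pos _
  let w : ℝ := τ * ((N : ℝ) + 1) ^ (-(1 / 3 : ℝ))
  have hw : 0 < w := mul_pos hτpos hℓ
  -- the net point below `s`
  obtain ⟨k₀, hk₀def⟩ : ∃ k₀ : ℕ, k₀ = ⌊s / δs⌋₊ := ⟨_, rfl⟩
  have hk₀ : k₀ ≤ Kmax := by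
    rw [hk₀def, hKmaxdef]; exact Nat.floor_mono (div_le_div_of_nonneg_right hs.2 hδs.le)
  let kf : Fin (Kmax + 1) := ⟨k₀, Nat.lt_succ_of_le hk₀⟩
  let s' : ℝ := sk kf
  have hs'eq : s' = (k₀ : ℝ) * δs := rfl
  have hs' : s' ∈ Icc (0 : ℝ) t₁ := hsk_mem kf
  have hss' : |s - s'| ≤ δs := by
    have h1 : s' ≤ s := by
      rw [hs'eq, hk₀def]
      have := Nat.floor_le (div_nonneg hs.1 hδs.le)
      calc (⌊s / δs⌋₊ : ℝ) * δs ≤ s / δs * δs := mul_le_mul_of_nonneg_right this hδs.le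
        _ = s := div_mul_cancel₀ s hδs.ne'
    have h2 : s < s' + δs := by
      rw [hs'eq, hk₀def]
      have := Nat.lt_floor_add_one (s / δs)
      have h3 : s / δs * δs < ((⌊s / δs⌋₊ : ℝ) + 1) * δs := mul_lt_mul_of_pos_right this hδs
      rw [div_mul_cancel₀ s hδs.ne'] at h3
      linarith
    rw [abs_le]; constructor <;> linarith
  -- closeness of the data at `s` and `s'`
  have hcl1 : ∀ x, |Real.log (a s x) - Real.log (a s' x)| ≤ ρ := fun x =>
    Real.dist_eq _ _ ▸ Hδ₁ s hs s' hs' (hss'.trans hδs1) x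
  have hcl2 : ∀ x, |θ₀ s x - θ₀ s' x| ≤ ρ := fun x => Real.dist_eq _ _ ▸ Hδ₂ s hs s' hs' (hss'.trans hδs2) x
  have hcl3 : ∀ x, ‖u₀ s x - u₀ s' x‖ ≤ min ρ κu := fun x =>
    dist_eq_norm (u₀ s x) (u₀ s' x) ▸ Hδ₃ s hs s' hs' (hss'.trans hδs3) x
  have hcl4 : ∀ x, |(Real.sqrt (θ₀ s x))⁻¹ - (Real.sqrt (θ₀ s' x))⁻¹| ≤ κ₁ := fun x =>
    Real.dist_eq _ _ ▸ Hδ₄ s hs s' hs' (hss'.trans hδs4) x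
  have hcl5 : ∀ x, |φ s x - φ s' x| ≤ ω := fun x => Real.dist_eq _ _ ▸ Hδ₅ s hs s' hs' (hss'.trans hδs5) x
  -- the two laws and their relation to the Liouville measure
  let P := localGibbsLaw σ (a s) (u₀ s) (θ₀ s) N (Φ N)
  let P' := localGibbsLaw σ (a s') (u₀ s') (θ₀ s') N (Φ N)
  let L := liouville (Torus.geometry (Fin 3)) (N + 1) (hsDiameter σ N)
  have hPac : P ≪ L := by
    show localGibbsLaw σ (a s) (u₀ s) (θ₀ s) N (Φ N) ≪ L
    rw [localGibbsLaw_eq]; exact localGibbsMeasure_absolutelyContinuous σ _ _ _ N (Φ N)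
  have hP'ac : P' ≪ L := by
    show localGibbsLaw σ (a s') (u₀ s') (θ₀ s') N (Φ N) ≪ L
    rw [localGibbsLaw_eq]; exact localGibbsMeasure_absolutelyContinuous σ _ _ _ N (Φ N)
  have hLgood : L (Φ N).goodᶜ = 0 := (Φ N).measure_compl_good
  have hP'good : P' (Φ N).goodᶜ = 0 := mem_ae_iff.1 (hP'ac.ae_le (Φ N).ae_mem_good)
  -- the four one-body observables
  let q : T3 × V3 → ℝ := fun y => φ s y.1 * g ((Real.sqrt (θ₀ s y.1))⁻¹ • (y.2 - u₀ s y.1))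
  let q₁ : T3 × V3 → ℝ := fun y => φ s' y.1 * g₆ ((Real.sqrt (θ₀ s' y.1))⁻¹ • (y.2 - u₀ s' y.1))
  let q₂ : T3 × V3 → ℝ := fun y => 6 * Λ * (1 + ‖y.2‖ ^ 2)
  let q₃ : T3 × V3 → ℝ := fun y => 1 * gt ((Real.sqrt (θ₀ s' y.1))⁻¹ • (y.2 - u₀ s' y.1))
  have hqc : Continuous q := continuous_productObs (hφc_s s) (hθc_s s) (hθ0 s) (huc_s s) hgc
  have hq₁c : Continuous q₁ := continuous_productObs (hφc_s s') (hθc_s s') (hθ0 s') (huc_s s') hg₆c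
  have hq₂c : Continuous q₂ :=
    continuous_const.mul (continuous_const.add ((continuous_norm.comp continuous_snd).pow 2))
  have hq₃c : Continuous q₃ :=
    continuous_productObs (φ := fun _ => (1 : ℝ)) continuous_const (hθc_s s') (hθ0 s') (huc_s s') hgtc
  -- the pointwise comparison
  have hle : ∀ y, 2 * q y ≤ (3 : ℝ)⁻¹ * (q₁ y + q₂ y + q₃ y) := by
    intro y
    have hcmp := observable_compare_avg (θ := θ₀ s y.1) (θ' := θ₀ s' y.1) (u := u₀ s y.1) (u' := u₀ s' y.1)
      (a := φ s y.1) (a' := φ s' y.1) hθm (hθm_le s hs y.1) (hθm_le s' hs' y.1) (hθM_ge s' hs' y.1)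
      (hU_ge s hs y.1) (hU_ge s' hs' y.1) (hcl4 y.1) ((hcl3 y.1).trans (min_le_right _ _)) hκ₁.le
      (hφ1 s' y.1) (hcl5 y.1) hB₀.le hc.le hR0 hgb hmod hκsum ht0 htR hsplit hα hγ y.2
    show 2 * (φ s y.1 * g ((Real.sqrt (θ₀ s y.1))⁻¹ • (y.2 - u₀ s y.1))) ≤
      (3 : ℝ)⁻¹ * (φ s' y.1 * (6 * g ((Real.sqrt (θ₀ s' y.1))⁻¹ • (y.2 - u₀ s' y.1))) +
        6 * Λ * (1 + ‖y.2‖ ^ 2) +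
        1 * (12 * c * C₂ θm U * C₃ θM U * t₀ ((Real.sqrt (θ₀ s' y.1))⁻¹ • (y.2 - u₀ s' y.1))))
    refine hcmp.trans_eq ?_
    rw [hΛdef]; ring
  -- the three bounds at the net point
  let Bd : ℝ≥0∞ := ENNReal.ofReal (Real.exp (ε' / 2 * ((N : ℝ) + 1)))
  have hNk1 : N1 kf ≤ N := (hN₀1 kf).trans hN
  have hNk2 : N2 kf ≤ N := (hN₀2 kf).trans hN
  have hB1 : ∫⁻ z, ENNReal.ofReal (Real.exp (∑ i, w⁻¹ * ∫ r in (0 : ℝ)..w, q₁ ((Φ N).flow r z i))) ∂P' ≤ Bd :=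
    HN1 kf N hNk1
  have hB3 : ∫⁻ z, ENNReal.ofReal (Real.exp (∑ i, w⁻¹ * ∫ r in (0 : ℝ)..w, q₃ ((Φ N).flow r z i))) ∂P' ≤ Bd :=
    HN2 kf N hNk2
  have hB2 : ∫⁻ z, ENNReal.ofReal (Real.exp (∑ i, w⁻¹ * ∫ r in (0 : ℝ)..w, q₂ ((Φ N).flow r z i))) ∂P' ≤ Bd := by
    have h := HE (a s') (θ₀ s') (u₀ s') (hac_s _) (hθc_s _) (huc_s _) (ha0 _) (hθ0 _) (hθM_ge _ hs')
      (hU_ge _ hs') σ hσ hσ2 N (Φ N) (6 * Λ) hlam0 hlamle w hw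
    refine h.trans (ENNReal.ofReal_le_ofReal (Real.exp_le_exp.2 ?_))
    exact mul_le_mul_of_nonneg_right hCElam hN1pos.le
  -- the rank split in inequality form: the doubled functional under `P'`
  have hdouble : ∫⁻ z, ENNReal.ofReal (Real.exp (2 * ∑ i, w⁻¹ * ∫ r in (0 : ℝ)..w, q ((Φ N).flow r z i))) ∂P' ≤
      Bd :=
    lintegral_exp_window_le_of_le_three (Φ N) hP'good hqc hq₁c hq₂c hq₃c hle hw.le hB1 hB2 hB3
  let G : Config (N + 1) (Fin 3) T3 → ℝ≥0∞ := fun z =>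
    ENNReal.ofReal (Real.exp (∑ i, w⁻¹ * ∫ r in (0 : ℝ)..w, q ((Φ N).flow r z i)))
  have hGae : AEMeasurable G L :=
    (Real.measurable_exp.comp_aemeasurable
      (KineticWindowGronwallProductKineticInstance.aemeasurable_windowSum (Φ N) hLgood hqc w)).ennreal_ofReal
  have HT' := HT (a s) (a s') (θ₀ s) (θ₀ s') (u₀ s) (u₀ s') (hac_s _) (hac_s _) (hθc_s _) (hθc_s _)
    (huc_s _) (huc_s _) (ha0 _) (ha0 _) (hθm_le s hs) (hθM_ge s hs) (hθm_le s' hs') (hθM_ge s' hs')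
    hcl1 hcl2 (fun x => (hcl3 x).trans (min_le_left _ _)) σ hσ hσ2 N (Φ N)
  have hchange : ∫⁻ z, G z ∂P ≤
      ENNReal.ofReal (Real.exp (ε' / 4 * ((N : ℝ) + 1))) * (∫⁻ z, G z ^ (2 : ℝ) ∂P') ^ (1 / 2 : ℝ) :=
    lintegral_le_of_forall_measurable hPac hP'ac HT' hGae
  have hG2 : ∫⁻ z, G z ^ (2 : ℝ) ∂P' ≤ Bd := by
    refine le_of_eq_of_le (lintegral_congr fun z => ?_) hdouble
    exact (KineticWindowGronwallWindowSubadditivity.ofReal_exp_mul_left 2 _ zero_le_two).symm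
  have hhalf : Bd ^ (1 / 2 : ℝ) = ENNReal.ofReal (Real.exp ((1 / 2 : ℝ) * (ε' / 2 * ((N : ℝ) + 1)))) :=
    (KineticWindowGronwallWindowSubadditivity.ofReal_exp_mul_left (1 / 2 : ℝ) _ (by norm_num)).symm
  show ∫⁻ z, G z ∂P ≤ ENNReal.ofReal (Real.exp (ε * ((N : ℝ) + 1)))
  calc ∫⁻ z, G z ∂P
      ≤ ENNReal.ofReal (Real.exp (ε' / 4 * ((N : ℝ) + 1))) * (∫⁻ z, G z ^ (2 : ℝ) ∂P') ^ (1 / 2 : ℝ) := hchange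
    _ ≤ ENNReal.ofReal (Real.exp (ε' / 4 * ((N : ℝ) + 1))) * Bd ^ (1 / 2 : ℝ) :=
        mul_le_mul_right (ENNReal.rpow_le_rpow hG2 (by norm_num)) _
    _ = ENNReal.ofReal (Real.exp ((ε' / 4 + ε' / 4) * ((N : ℝ) + 1))) := by
        rw [hhalf, ← ENNReal.ofReal_mul (Real.exp_pos _).le, ← Real.exp_add]
        congr 2; ring
    _ ≤ ENNReal.ofReal (Real.exp (ε * ((N : ℝ) + 1))) := by
        refine ENNReal.ofReal_le_ofReal (Real.exp_le_exp.2 (mul_le_mul_of_nonneg_right ?_ hN1pos.le))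
        linarith

/-! ## §4 The registered helper statement of this file -/

/-- Helper statement `FamilyGlueOfHelpers` (helper stub `stub_familyGlueOfHelpers` of `stub_familyGlue`, line
rare-band-ladder-dock v7, file 3 of 3): the family glue GIVEN its three registered helper statements — the
unconditional `stub_familyGlue : FamilyGlue` follows by feeding the landed `stub_twoProfileTransfer`,
`stub_windowEnergyMoment`, `stub_tailReorth` (same terms). Route-internal, not a cited fact. -/
def FamilyGlueOfHelpers : Prop :=
  TwoProfileTransfer → WindowEnergyMoment → TailReorth → FamilyGlue

/-- **Registered helper stub `stub_familyGlueOfHelpers`** (file 3 of 3): `FamilyGlueOfHelpers` holds (`familyGlue_of`).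
[cite: OllaVaradhanYau1993, §3] -/
theorem stub_familyGlueOfHelpers : FamilyGlueOfHelpers :=
  familyGlue_of

end Summit.AtomisticToContinuum.HydrodynamicLimit.Theorems.KineticWindowGronwallFamilyGlue

end
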